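import Summits.CriticalPhenomena.PercolationContinuityZ3.Theorems.PercRayRenewalTwoArmsRatioExponentFSNormalForms

/-!
# Crux `PercRayRenewal.TwoArmsRatioExponent` (stmt-CriticalPhenomena-4625) — the exact GAP between the
# registered stub FS and the crux: a quantifier swap (uniformity in the inner scale)

Line lead prover-line-stmt-CriticalPhenomena-4625-c3-0 (cycle 3), companion of
`…FSNormalForms.lean`.  Bond percolation on `ℤ³` at `p_c` (`critBond`); `A₂(k, m) = twoClusterEvt k m`;
`outer(s, n) = (· ∩ E(Λ s)ᶜ) ⁻¹' A₂(s, n)` (local notations `E⟦r⟧`, `outer⟦s, n⟧`; no definitions).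

* `real_outer_mul_le_real_twoClusterEvt` — **finite-energy comparison at a FIXED inner scale**:
  `P(outer(s, n)) · (1 - p_c)^{|E_{ℤ³}(Λ s)|} ≤ P(A₂(s, n))` (close every lattice pair inside `Λ(s)`,
  an event independent of the annulus event; on the intersection the configuration equals its
  thinning).  The constant is `e^{O(s³)}`: NOT uniform in `s`.
* `outer_law_of_twoArmsRatioExponent` — hence the crux T2 gives the thinned law at every fixed
  inner scale, `P(outer(s, n)) ≤ C_s (s/n)^c`, and
* registered sub-goal **`outer_eventually_aspect_of_twoArmsRatioExponent`** —
  **T2 ⇒ ∃ c > 1, ∀ s ≥ 1, ∀ᶠ M, P(outer(s, M s)) ≤ M^{-c}.**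

Compare `finiteSizeCriterion_iff_eventually_aspect` (FS ⇔ ∃ c > 1, ∀ᶠ M, ∀ s ≥ 1, …): the single
stub FS of skeleton v3 is the crux PLUS uniformity of the aspect threshold in the inner scale `s` —
i.e. exactly the `s`-uniform thinning/gluing comparison `P(outer(s,n)) ≤ K P(A₂(s,n))` that no 3D
technique supplies (numerically `K ≈ 1.25`, flat in `s`, own MC j024157) — and nothing more.

* `finiteSizeCriterion_routeForm_iff` — the ITEM-READY spelling of FS over `Literature` vocabulary only
  (measure `bondPercolation (zdGraph 3) (criticalProbI 3)`, the crux's inline event, thinning as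
  `ω \ E(Λ s)`), as a `Theses` file would have to state it, is equivalent to the registered stub —
  for the planner who promotes FS to a statement item.

Sorry-free; no definitions.
-/

namespace Summit.CriticalPhenomena.PercolationContinuityZ3.Theorems.TwoArmsRatioExponent

open MeasureTheory Filter Topology
open Literature.Probability.LatticeModels Literature.Probability.Percolation
open Summit.CriticalPhenomena.PercolationContinuityZ3.Theses
open Summit.CriticalPhenomena.PercolationContinuityZ3.Theorems.NearLinearTwoClusterDecay.Negative

noncomputable section

set_option quotPrecheck false in
/-- `E⟦r⟧` — the pairs inside `Λ(r)`; a local notation, not a definition. -/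
local notation "E⟦" r "⟧" => Set.sym2 (↑(box 3 r) : Set (Site 3))

set_option quotPrecheck false in
/-- `outer⟦s, n⟧` — the two-cluster event `A₂(s, n)` of the configuration thinned by `E⟦s⟧`; a
local notation, not a definition. -/
local notation "outer⟦" s ", " n "⟧" =>
  (fun ω : BondConfig (Site 3) => ω ∩ (Set.sym2 (↑(box 3 s) : Set (Site 3)))ᶜ) ⁻¹' twoClusterEvt s n

/-! ## The finite-energy comparison at a fixed inner scale -/

/-- On a lattice configuration with every lattice pair inside `Λ(s)` closed the thinning by
`E(s)` removes nothing, so there `outer(s, n)` IS `A₂(s, n)`. [folklore] -/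
theorem mem_twoClusterEvt_of_outer_of_closed {s n : ℕ} {ω : BondConfig (Site 3)}
    (hω : ω ⊆ (zdGraph 3).edgeSet) (h : ω ∈ outer⟦s, n⟧)
    (hcl : ∀ e ∈ edgesIn (zdGraph 3) (box 3 s), e ∉ ω) : ω ∈ twoClusterEvt s n := by
  have hωE : ω ∩ (E⟦s⟧)ᶜ = ω := by
    refine Set.inter_eq_left.2 fun e he hE => hcl e ?_ he
    rw [mem_edgesIn_iff]
    refine ⟨hω he, ?_⟩
    intro x hx
    have hsub := Set.mem_sym2_iff_subset.1 hE
    exact Finset.mem_coe.1 (hsub hx)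
  have h' : ω ∩ (E⟦s⟧)ᶜ ∈ twoClusterEvt s n := h
  rwa [hωE] at h'

/-- The lattice pairs inside `Λ(s)` lie in `E(s)`. [folklore] -/
theorem coe_edgesIn_subset_innerPairs (s : ℕ) :
    (↑(edgesIn (zdGraph 3) (box 3 s)) : Set (Sym2 (Site 3))) ⊆ E⟦s⟧ := by
  intro e he
  have he' := (mem_edgesIn_iff.1 (Finset.mem_coe.1 he)).2
  rw [Set.mem_sym2_iff_subset]
  intro x hx
  exact Finset.mem_coe.2 (he' x hx)

/-- **Finite-energy comparison at a fixed inner scale**: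
`P(outer(s, n)) · (1 - p_c)^{|E_{ℤ³}(Λ(s))|} ≤ P(A₂(s, n))` — close every lattice pair inside
`Λ(s)` (an event of the pairs `E(s)`, independent of the annulus event `outer(s, n)`); on the
intersection the configuration equals its thinning.  The constant depends on `s` (≈ `e^{O(s³)}`),
which is exactly why this does not make FS and the crux equivalent. [folklore] -/
theorem real_outer_mul_le_real_twoClusterEvt (s n : ℕ) :
    critBond.real (outer⟦s, n⟧) * (1 - (criticalProbI 3 : ℝ)) ^ (edgesIn (zdGraph 3) (box 3 s)).card ≤
      critBond.real (twoClusterEvt s n) := by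
  set F := edgesIn (zdGraph 3) (box 3 s) with hF
  have hB := le_bondPercolation_real_forall_notMem (zdGraph 3) (criticalProbI 3) F
  have hdisj : Disjoint (E⟦s⟧)ᶜ (↑F : Set (Sym2 (Site 3))) :=
    Set.disjoint_of_subset_right (coe_edgesIn_subset_innerPairs s) disjoint_compl_left
  have hprod := bondPercolation_real_inter_of_disjoint (zdGraph 3) (criticalProbI 3) hdisj
    (determinedBy_outerTwoClusterEvt s n) (determinedBy_forall_notMem F)
    (measurableSet_outerTwoClusterEvt s n) (measurableSet_forall_notMem F)
  calc critBond.real (outer⟦s, n⟧) * (1 - (criticalProbI 3 : ℝ)) ^ F.card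
      ≤ critBond.real (outer⟦s, n⟧) * critBond.real {ω : BondConfig (Site 3) | ∀ e ∈ F, e ∉ ω} :=
        mul_le_mul_of_nonneg_left hB measureReal_nonneg
    _ = critBond.real (outer⟦s, n⟧ ∩ {ω : BondConfig (Site 3) | ∀ e ∈ F, e ∉ ω}) := hprod.symm
    _ ≤ critBond.real (twoClusterEvt s n) :=
        DCT16.real_mono_of_forall_subset_edgeSet _ _ fun ω hω hmem =>
          mem_twoClusterEvt_of_outer_of_closed hω hmem.1 hmem.2

/-- **T2 ⇒ the thinned law at every FIXED inner scale**: from the crux, for every `s ≥ 1` there is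
`C_s = C (1 - p_c)^{-|E(Λ s)|}` with `P(outer(s, n)) ≤ C_s (s/n)^c` for all `n ≥ s` (same `c > 1`).
[folklore] -/
theorem outer_law_of_twoArmsRatioExponent (hT2 : PercRayRenewal.TwoArmsRatioExponent) :
    ∃ c : ℝ, 1 < c ∧ ∀ s : ℕ, 1 ≤ s → ∃ C : ℝ, ∀ n : ℕ, s ≤ n →
      critBond.real (outer⟦s, n⟧) ≤ C * ((s : ℝ) / n) ^ c := by
  have h' := hT2
  unfold PercRayRenewal.TwoArmsRatioExponent at h'
  simp only [setOf_stubEvt_eq_twoClusterEvt] at h'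
  obtain ⟨c, C, hc, hP⟩ := h'
  refine ⟨c, hc, fun s hs => ?_⟩
  set q : ℝ := (1 - (criticalProbI 3 : ℝ)) ^ (edgesIn (zdGraph 3) (box 3 s)).card with hq
  have hpc : (criticalProbI 3 : ℝ) < 1 := by
    rw [coe_criticalProbI]
    exact (Grimmett1999_criticalProb_pos_lt_one_holds 3 (by norm_num)).2
  have hq0 : 0 < q := pow_pos (sub_pos.2 hpc) _
  refine ⟨C / q, fun n hsn => ?_⟩
  have h1 : critBond.real (outer⟦s, n⟧) * q ≤ critBond.real (twoClusterEvt s n) :=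
    real_outer_mul_le_real_twoClusterEvt s n
  have h2 := hP s n hs hsn
  calc critBond.real (outer⟦s, n⟧) = critBond.real (outer⟦s, n⟧) * q / q := by
        field_simp
    _ ≤ C * ((s : ℝ) / n) ^ c / q := div_le_div_of_nonneg_right (h1.trans h2) hq0.le
    _ = C / q * ((s : ℝ) / n) ^ c := by ring

/-- Arithmetic of the aspect threshold: if `max C 1 ≤ M^{c - c'}` (`M > 0`) then
`C · (M^c)⁻¹ ≤ M^{-c'}`. [folklore] -/
theorem mul_inv_rpow_le_rpow_neg {C c c' M : ℝ} (hM : 0 < M) (hCM : max C 1 ≤ M ^ (c - c')) :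
    C * (M ^ c)⁻¹ ≤ M ^ (-c') := by
  have hC1 : C ≤ M ^ (c - c') := le_trans (le_max_left _ _) hCM
  calc C * (M ^ c)⁻¹ ≤ M ^ (c - c') * (M ^ c)⁻¹ :=
        mul_le_mul_of_nonneg_right hC1 (inv_nonneg.2 (Real.rpow_nonneg hM.le c))
    _ = M ^ (-c') := by
        rw [← Real.rpow_neg hM.le, ← Real.rpow_add hM]
        congr 1; ring

/-- Arithmetic of the aspect threshold: `⌈(max C 1)^{1/δ}⌉₊ ≤ M` with `δ > 0` gives
`max C 1 ≤ M^δ`. [folklore] -/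
theorem max_le_rpow_of_ceil_le {C δ : ℝ} (hδ : 0 < δ) {M : ℕ}
    (hM : ⌈(max C 1) ^ (1 / δ)⌉₊ ≤ M) : max C 1 ≤ (M : ℝ) ^ δ := by
  have h1 : (max C 1) ^ (1 / δ) ≤ (M : ℝ) := le_trans (Nat.le_ceil _) (by exact_mod_cast hM)
  have h0 : 0 ≤ max C 1 := le_trans zero_le_one (le_max_right _ _)
  calc max C 1 = ((max C 1) ^ (1 / δ)) ^ δ := by
        rw [← Real.rpow_mul h0, one_div, inv_mul_cancel₀ hδ.ne', Real.rpow_one]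
    _ ≤ (M : ℝ) ^ δ := Real.rpow_le_rpow (Real.rpow_nonneg h0 _) h1 hδ.le

/-- **The quantifier gap between the crux and FS.**  The crux gives
`∃ c > 1, ∀ s ≥ 1, ∀ᶠ M, P(outer(s, M s)) ≤ M^{-c}` (aspect threshold depending on the inner scale,
through the finite-energy constant `(1 - p_c)^{-|E(Λ s)|}`), whereas FS is
`∃ c > 1, ∀ᶠ M, ∀ s ≥ 1, P(outer(s, M s)) ≤ M^{-c}` (`finiteSizeCriterion_iff_eventually_aspect`):
FS = crux + UNIFORMITY of the aspect threshold in the inner scale — the r-uniform thinning /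
gluing comparison that no 3D technique supplies (numerically the ratio is `κ ≈ 1.25`, flat in s).
[folklore] -/
theorem outer_eventually_aspect_of_twoArmsRatioExponent : Summit.CriticalPhenomena.PercolationContinuityZ3.Theses.PercRayRenewal.TwoArmsRatioExponent → ∃ c : ℝ, 1 < c ∧ ∀ s : ℕ, 1 ≤ s → ∀ᶠ M : ℕ in Filter.atTop, critBond.real ((fun ω : BondConfig (Site 3) => ω ∩ (Set.sym2 (↑(box 3 s) : Set (Site 3)))ᶜ) ⁻¹' twoClusterEvt s (M * s)) ≤ (M : ℝ) ^ (-c) := by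
  intro hT2
  obtain ⟨c, hc, h⟩ := outer_law_of_twoArmsRatioExponent hT2
  set c' : ℝ := (1 + c) / 2 with hc'
  have hc'1 : 1 < c' := by rw [hc']; linarith
  have hδ : 0 < c - c' := by rw [hc']; linarith
  refine ⟨c', hc'1, fun s hs => ?_⟩
  obtain ⟨C, hC⟩ := h s hs
  filter_upwards [eventually_ge_atTop (max 2 ⌈(max C 1) ^ (1 / (c - c'))⌉₊)] with M hMge
  have hM2 : 2 ≤ M := le_trans (le_max_left _ _) hMge
  have hMpos : (0 : ℝ) < M := by exact_mod_cast (lt_of_lt_of_le (by norm_num) hM2 : 0 < M)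
  have hCM : max C 1 ≤ (M : ℝ) ^ (c - c') :=
    max_le_rpow_of_ceil_le hδ (le_trans (le_max_right _ _) hMge)
  have hsMs : s ≤ M * s := Nat.le_mul_of_pos_left s (by omega)
  have hmain := hC (M * s) hsMs
  have hratio : ((s : ℝ) / ((M * s : ℕ) : ℝ)) = (M : ℝ)⁻¹ := by
    have hs0 : (0 : ℝ) < s := by exact_mod_cast hs
    rw [Nat.cast_mul]; field_simp
  rw [hratio, Real.inv_rpow hMpos.le] at hmain
  exact hmain.trans (mul_inv_rpow_le_rpow_neg hMpos hCM)

/-! ## Item-ready spelling of FS (Literature vocabulary only, as a Theses file must state it) -/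

/-- **FS in route vocabulary.**  The registered stub FS spelled over `Literature` names only (the
measure `bondPercolation (zdGraph 3) (criticalProbI 3)`, the crux's inline two-distinct-clusters
event, and the thinning written as the set difference `ω \ E(Λ s)`), as a planner would file it in a
`Theses` file, is EQUIVALENT (after `Set.sdiff_eq` and the event identity
`setOf_stubEvt_eq_twoClusterEvt`) to the registered stub `stub_finiteSizeCriterion`. [folklore] -/
theorem finiteSizeCriterion_routeForm_iff :
    (∃ M s₀ : ℕ, 2 ≤ M ∧ 1 ≤ s₀ ∧ ∃ c : ℝ, 1 < c ∧ ∀ s : ℕ, s₀ ≤ s →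
      (Literature.Probability.Percolation.bondPercolation (Literature.Probability.LatticeModels.zdGraph 3)
        (Literature.Probability.Percolation.criticalProbI 3)).real
        {ω | ∃ u ∈ Literature.Probability.LatticeModels.box 3 s, ∃ v ∈ Literature.Probability.LatticeModels.box 3 s,
          (∃ y ∈ Literature.Probability.LatticeModels.innerBoundary (Literature.Probability.LatticeModels.zdGraph 3)
              (Literature.Probability.LatticeModels.box 3 (M * s)),
            ω \ Set.sym2 (↑(Literature.Probability.LatticeModels.box 3 s) : Set (Literature.Probability.LatticeModels.Site 3)) ∈
              Literature.Probability.Percolation.openConnIn ↑(Literature.Probability.LatticeModels.box 3 (M * s)) u y) ∧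
          (∃ y ∈ Literature.Probability.LatticeModels.innerBoundary (Literature.Probability.LatticeModels.zdGraph 3)
              (Literature.Probability.LatticeModels.box 3 (M * s)),
            ω \ Set.sym2 (↑(Literature.Probability.LatticeModels.box 3 s) : Set (Literature.Probability.LatticeModels.Site 3)) ∈
              Literature.Probability.Percolation.openConnIn ↑(Literature.Probability.LatticeModels.box 3 (M * s)) v y) ∧
          ω \ Set.sym2 (↑(Literature.Probability.LatticeModels.box 3 s) : Set (Literature.Probability.LatticeModels.Site 3)) ∉
            Literature.Probability.Percolation.openConnIn ↑(Literature.Probability.LatticeModels.box 3 (M * s)) u v} ≤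
        (M : ℝ) ^ (-c)) ↔
    (∃ M s₀ : ℕ, 2 ≤ M ∧ 1 ≤ s₀ ∧ ∃ c : ℝ, 1 < c ∧ ∀ s : ℕ, s₀ ≤ s →
      critBond.real ((fun ω : BondConfig (Site 3) => ω ∩ (Set.sym2 (↑(box 3 s) : Set (Site 3)))ᶜ) ⁻¹'
        twoClusterEvt s (M * s)) ≤ (M : ℝ) ^ (-c)) := by
  have key : ∀ M s : ℕ,
      {ω : BondConfig (Site 3) | ∃ u ∈ box 3 s, ∃ v ∈ box 3 s,
          (∃ y ∈ innerBoundary (zdGraph 3) (box 3 (M * s)),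
            ω \ Set.sym2 (↑(box 3 s) : Set (Site 3)) ∈ openConnIn ↑(box 3 (M * s)) u y) ∧
          (∃ y ∈ innerBoundary (zdGraph 3) (box 3 (M * s)),
            ω \ Set.sym2 (↑(box 3 s) : Set (Site 3)) ∈ openConnIn ↑(box 3 (M * s)) v y) ∧
          ω \ Set.sym2 (↑(box 3 s) : Set (Site 3)) ∉ openConnIn ↑(box 3 (M * s)) u v} =
        (fun ω : BondConfig (Site 3) => ω ∩ (Set.sym2 (↑(box 3 s) : Set (Site 3)))ᶜ) ⁻¹'
          twoClusterEvt s (M * s) := by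
    intro M s
    rw [← setOf_stubEvt_eq_twoClusterEvt]
    ext ω
    simp only [Set.mem_setOf_eq, Set.mem_preimage, Set.sdiff_eq]
  simp only [key]

end

end Summit.CriticalPhenomena.PercolationContinuityZ3.Theorems.TwoArmsRatioExponent
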